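import Mathlib.Analysis.Calculus.Deriv.Inverse
import Mathlib.Analysis.Calculus.Deriv.MeanValue
import Mathlib.Analysis.Calculus.Deriv.Slope
import Mathlib.Topology.Order.MonotoneContinuity
import Mathlib.Topology.Order.IntermediateValue
import Mathlib.Order.Monotone.Union
import HarnessLib

/-!
# GridStability/Models/OrbitGraph — phase-plane orbits as graphs `ω = W(δ)` (toolkit)

Cell `gridfusion` (LADDER-GRIDFUSION G1-cct, SMIB threshold question), seat gridfusion-model-1,
`plan/PARTITION.md` §0 row `Models/`. Pure real analysis used by `SMIBClearingThreshold.lean`: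
along an arc of a planar motion `t ↦ (δ(t), ω(t))`, `t ∈ [a, b]`, on which the angle `δ` is strictly
increasing, the orbit is the graph of `W = ω ∘ δ⁻¹` over `[δ(a), δ(b)]` («`dω/dδ = ω̇/δ̇`», the
phase-plane form of the swing equation used in every first-swing / equal-area argument,
[cite: Kundur1994, §13.1.3]; [cite: SauerPai1998, §9.6.3]).  This file supplies:

* `clampExt δ a b` — the strictly increasing continuous extension of `δ|[a,b]` to all of `ℝ`
  (slope-one rays outside `[a, b]`), so that the inverse is a globally defined continuous map;
* `arcInv δ a b` — its inverse (`Function.invFun`): continuity, two-sided inverse identities on the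
  arc, monotonicity, and the inverse-function derivative `(δ⁻¹)'(y) = 1/δ'(δ⁻¹ y)` at interior points;
* `barrier_induction` — the «continuous induction» form of a phase-plane barrier argument: a
  continuous comparison `v ≤ B ∘ u` on `[0, S]` propagates from `0` provided it re-establishes itself
  to the right of every contact point;
* `eventually_pos_of_hasDerivWithinAt` — a function vanishing at `x` with positive right derivative
  is positive immediately to the right of `x`;
* `exists_firstZero` — the FIRST zero of a continuous speed that starts positive and is `≤ 0` later
  (the «first turn» of a swing).

No model content; nothing here is specific to power systems. [folklore]
-/

noncomputable section

open Set Filter Topology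

namespace Summit.Ventures.GridStability.Models.OrbitGraph

/-! ### The clamp extension of a strictly increasing arc -/

/-- Slope-one extension of `δ|[a,b]` to `ℝ`: `δ a + (t − a)` left of `a`, `δ t` on `[a, b]`,
`δ b + (t − b)` right of `b`. [folklore] -/
def clampExt (δ : ℝ → ℝ) (a b : ℝ) (t : ℝ) : ℝ :=
  δ (max a (min t b)) + (max (t - b) 0 - max (a - t) 0)

variable {δ : ℝ → ℝ} {a b : ℝ}

/-- On the arc the extension is `δ` itself. [folklore] -/
theorem clampExt_eq_of_mem {t : ℝ} (ht : t ∈ Icc a b) : clampExt δ a b t = δ t := by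
  have h1 : min t b = t := min_eq_left ht.2
  have h2 : max a t = t := max_eq_right ht.1
  have h3 : max (t - b) 0 = 0 := max_eq_right (by linarith [ht.2])
  have h4 : max (a - t) 0 = 0 := max_eq_right (by linarith [ht.1])
  simp [clampExt, h1, h2, h3, h4]

/-- Left of `a` the extension is the ray `δ a + (t − a)`. [folklore] -/
theorem clampExt_eq_of_le (hab : a ≤ b) {t : ℝ} (ht : t ≤ a) :
    clampExt δ a b t = δ a + (t - a) := by
  have h1 : max a (min t b) = a := max_eq_left (le_trans (min_le_left _ _) ht)
  have h3 : max (t - b) 0 = 0 := max_eq_right (by linarith)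
  have h4 : max (a - t) 0 = a - t := max_eq_left (by linarith)
  simp only [clampExt, h1, h3, h4]
  ring

/-- Right of `b` the extension is the ray `δ b + (t − b)`. [folklore] -/
theorem clampExt_eq_of_ge (hab : a ≤ b) {t : ℝ} (ht : b ≤ t) :
    clampExt δ a b t = δ b + (t - b) := by
  have h1 : max a (min t b) = b := by rw [min_eq_right ht, max_eq_right hab]
  have h3 : max (t - b) 0 = t - b := max_eq_left (by linarith)
  have h4 : max (a - t) 0 = 0 := max_eq_right (by linarith)
  simp only [clampExt, h1, h3, h4]
  ring

/-- The extension of a strictly increasing arc is strictly increasing on `ℝ`. [folklore] -/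
theorem strictMono_clampExt (hab : a ≤ b) (hδ : StrictMonoOn δ (Icc a b)) :
    StrictMono (clampExt δ a b) := by
  have hL : StrictMonoOn (clampExt δ a b) (Iic a) := by
    intro t ht t' ht' hlt
    rw [clampExt_eq_of_le hab (mem_Iic.1 ht), clampExt_eq_of_le hab (mem_Iic.1 ht')]
    linarith
  have hM : StrictMonoOn (clampExt δ a b) (Icc a b) := by
    intro t ht t' ht' hlt
    rw [clampExt_eq_of_mem ht, clampExt_eq_of_mem ht']
    exact hδ ht ht' hlt
  have hR : StrictMonoOn (clampExt δ a b) (Ici b) := by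
    intro t ht t' ht' hlt
    rw [clampExt_eq_of_ge hab (mem_Ici.1 ht), clampExt_eq_of_ge hab (mem_Ici.1 ht')]
    linarith
  have hMR : StrictMonoOn (clampExt δ a b) (Ici a) := by
    have h := hM.union hR ⟨right_mem_Icc.2 hab, fun x hx => hx.2⟩ ⟨self_mem_Ici, fun x hx => hx⟩
    have hset : Icc a b ∪ Ici b = Ici a := by
      ext x
      simp only [mem_union, mem_Icc, mem_Ici]
      constructor
      · rintro (⟨h1, _⟩ | h1)
        · exact h1
        · exact hab.trans h1
      · intro h1
        rcases le_total x b with h2 | h2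
        · exact Or.inl ⟨h1, h2⟩
        · exact Or.inr h2
    rwa [hset] at h
  exact hL.Iic_union_Ici hMR

/-- The extension of a continuous arc is continuous on `ℝ`. [folklore] -/
theorem continuous_clampExt (hab : a ≤ b) (hδ : ContinuousOn δ (Icc a b)) :
    Continuous (clampExt δ a b) := by
  have h1 : Continuous fun t : ℝ => δ (max a (min t b)) :=
    hδ.comp_continuous (continuous_const.max (continuous_id.min continuous_const))
      (fun t => ⟨le_max_left _ _, max_le hab (min_le_right _ _)⟩)
  have h2 : Continuous fun t : ℝ => max (t - b) 0 - max (a - t) 0 :=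
    ((continuous_id.sub continuous_const).max continuous_const).sub
      ((continuous_const.sub continuous_id).max continuous_const)
  exact h1.add h2

/-- The extension is surjective (it is continuous and tends to `±∞` along the rays). [folklore] -/
theorem surjective_clampExt (hab : a ≤ b) (hδ : ContinuousOn δ (Icc a b)) :
    Function.Surjective (clampExt δ a b) := by
  refine (continuous_clampExt hab hδ).surjective ?_ ?_
  · have h : ∀ᶠ t in atTop, (fun t => t + (δ b - b)) t = clampExt δ a b t := by
      filter_upwards [eventually_ge_atTop b] with t ht
      rw [clampExt_eq_of_ge hab ht]
      ring
    exact Tendsto.congr' h (tendsto_atTop_add_const_right _ _ tendsto_id)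
  · have h : ∀ᶠ t in atBot, (fun t => t + (δ a - a)) t = clampExt δ a b t := by
      filter_upwards [eventually_le_atBot a] with t ht
      rw [clampExt_eq_of_le hab ht]
      ring
    exact Tendsto.congr' h (tendsto_atBot_add_const_right _ _ tendsto_id)

/-! ### The inverse of the arc -/

/-- The inverse `δ⁻¹ : ℝ → ℝ` of the extended arc (a two-sided inverse of `clampExt δ a b` when the
arc is strictly increasing and continuous). [folklore] -/
def arcInv (δ : ℝ → ℝ) (a b : ℝ) : ℝ → ℝ := Function.invFun (clampExt δ a b)

/-- `δ⁻¹ (δ̃ t) = t` on `ℝ` (`δ̃` the extension). [folklore] -/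
theorem arcInv_clampExt (hab : a ≤ b) (hδ : StrictMonoOn δ (Icc a b)) (t : ℝ) :
    arcInv δ a b (clampExt δ a b t) = t :=
  Function.leftInverse_invFun (strictMono_clampExt hab hδ).injective t

/-- `δ̃ (δ⁻¹ y) = y` on `ℝ`. [folklore] -/
theorem clampExt_arcInv (hab : a ≤ b) (hδc : ContinuousOn δ (Icc a b)) (y : ℝ) :
    clampExt δ a b (arcInv δ a b y) = y :=
  Function.invFun_eq (surjective_clampExt hab hδc y)

/-- `δ⁻¹ (δ t) = t` for `t ∈ [a, b]`. [folklore] -/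
theorem arcInv_apply (hab : a ≤ b) (hδ : StrictMonoOn δ (Icc a b)) {t : ℝ} (ht : t ∈ Icc a b) :
    arcInv δ a b (δ t) = t := by
  rw [← clampExt_eq_of_mem (δ := δ) ht]
  exact arcInv_clampExt hab hδ t

/-- The inverse is strictly increasing. [folklore] -/
theorem strictMono_arcInv (hab : a ≤ b) (hδc : ContinuousOn δ (Icc a b))
    (hδ : StrictMonoOn δ (Icc a b)) : StrictMono (arcInv δ a b) := by
  intro y y' h
  by_contra hle
  push Not at hle
  have := (strictMono_clampExt hab hδ).monotone hle
  rw [clampExt_arcInv hab hδc, clampExt_arcInv hab hδc] at this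
  exact absurd h (not_lt.2 this)

/-- The inverse is continuous on `ℝ` (a monotone surjection onto `ℝ`). [folklore] -/
theorem continuous_arcInv (hab : a ≤ b) (hδc : ContinuousOn δ (Icc a b))
    (hδ : StrictMonoOn δ (Icc a b)) : Continuous (arcInv δ a b) := by
  refine (strictMono_arcInv hab hδc hδ).monotone.continuous_of_surjective fun t => ?_
  exact ⟨clampExt δ a b t, arcInv_clampExt hab hδ t⟩

/-- The inverse maps `[δ a, δ b]` into `[a, b]`. [folklore] -/
theorem arcInv_mem (hab : a ≤ b) (hδc : ContinuousOn δ (Icc a b)) (hδ : StrictMonoOn δ (Icc a b))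
    {y : ℝ} (hy : y ∈ Icc (δ a) (δ b)) : arcInv δ a b y ∈ Icc a b := by
  have hm := (strictMono_arcInv hab hδc hδ).monotone
  constructor
  · have := hm hy.1
    rwa [arcInv_apply hab hδ (left_mem_Icc.2 hab)] at this
  · have := hm hy.2
    rwa [arcInv_apply hab hδ (right_mem_Icc.2 hab)] at this

/-- `δ (δ⁻¹ y) = y` for `y ∈ [δ a, δ b]`. [folklore] -/
theorem apply_arcInv (hab : a ≤ b) (hδc : ContinuousOn δ (Icc a b)) (hδ : StrictMonoOn δ (Icc a b))
    {y : ℝ} (hy : y ∈ Icc (δ a) (δ b)) : δ (arcInv δ a b y) = y := by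
  have h := clampExt_arcInv hab hδc y
  rwa [clampExt_eq_of_mem (arcInv_mem hab hδc hδ hy)] at h

/-- Strictly inside the arc: `δ⁻¹ y ∈ (a, b)` for `y ∈ (δ a, δ b)`. [folklore] -/
theorem arcInv_mem_Ioo (hab : a ≤ b) (hδc : ContinuousOn δ (Icc a b))
    (hδ : StrictMonoOn δ (Icc a b)) {y : ℝ} (hy : y ∈ Ioo (δ a) (δ b)) :
    arcInv δ a b y ∈ Ioo a b := by
  have hm := strictMono_arcInv hab hδc hδ
  constructor
  · have := hm hy.1
    rwa [arcInv_apply hab hδ (left_mem_Icc.2 hab)] at this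
  · have := hm hy.2
    rwa [arcInv_apply hab hδ (right_mem_Icc.2 hab)] at this

/-- **Inverse-function derivative on the arc**: if `δ⁻¹ y` is an interior time at which `δ` has
derivative `d ≠ 0`, then `δ⁻¹` has derivative `d⁻¹` at `y`. [folklore] -/
theorem hasDerivAt_arcInv (hab : a ≤ b) (hδc : ContinuousOn δ (Icc a b))
    (hδ : StrictMonoOn δ (Icc a b)) {y d : ℝ} (hy : arcInv δ a b y ∈ Ioo a b)
    (hd : HasDerivAt δ d (arcInv δ a b y)) (hd0 : d ≠ 0) :
    HasDerivAt (arcInv δ a b) d⁻¹ y := by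
  have hext : HasDerivAt (clampExt δ a b) d (arcInv δ a b y) := by
    refine hd.congr_of_eventuallyEq ?_
    filter_upwards [Ioo_mem_nhds hy.1 hy.2] with t ht
    exact clampExt_eq_of_mem (Ioo_subset_Icc_self ht)
  exact hext.of_local_left_inverse (continuous_arcInv hab hδc hδ).continuousAt hd0
    (Eventually.of_forall fun y' => clampExt_arcInv hab hδc y')

/-! ### First zero of the speed -/

/-- **First turn.** A continuous `ω` with `ω 0 > 0` and `ω s₂ ≤ 0` for some `s₂ ≥ 0` has a FIRST
zero `s₁ ∈ (0, s₂]`, with `ω > 0` on `[0, s₁)`. [folklore] -/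
theorem exists_firstZero {ω : ℝ → ℝ} (hc : Continuous ω) (h0 : 0 < ω 0) {s₂ : ℝ} (hs₂ : 0 ≤ s₂)
    (hle : ω s₂ ≤ 0) : ∃ s₁, 0 < s₁ ∧ s₁ ≤ s₂ ∧ ω s₁ = 0 ∧ ∀ s ∈ Ico 0 s₁, 0 < ω s := by
  set Z : Set ℝ := {s | 0 ≤ s ∧ ω s ≤ 0} with hZ
  have hZc : IsClosed Z :=
    (isClosed_le continuous_const continuous_id).inter (isClosed_le hc continuous_const)
  have hne : Z.Nonempty := ⟨s₂, hs₂, hle⟩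
  have hbdd : BddBelow Z := ⟨0, fun s hs => hs.1⟩
  have hmem : sInf Z ∈ Z := hZc.csInf_mem hne hbdd
  have hle₂ : sInf Z ≤ s₂ := csInf_le hbdd ⟨hs₂, hle⟩
  have hpos : ∀ s ∈ Ico 0 (sInf Z), 0 < ω s := fun s hs => by
    by_contra h
    push Not at h
    exact absurd hs.2 (not_lt.2 (csInf_le hbdd ⟨hs.1, h⟩))
  have h1 : 0 < sInf Z := by
    rcases hmem.1.lt_or_eq with h | h
    · exact h
    · exfalso
      have h2 := hmem.2
      rw [← h] at h2
      exact absurd h2 (not_le.2 h0)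
  refine ⟨sInf Z, h1, hle₂, le_antisymm hmem.2 ?_, hpos⟩
  by_contra hneg
  push Not at hneg
  obtain ⟨l, u, ⟨hl, hu⟩, hsub⟩ := mem_nhds_iff_exists_Ioo_subset.1
    (hc.continuousAt.eventually (gt_mem_nhds hneg))
  set s : ℝ := (max l 0 + sInf Z) / 2 with hs
  have hml : max l 0 < sInf Z := max_lt hl h1
  have hs1 : s < sInf Z := by rw [hs]; linarith
  have hs2 : max l 0 < s := by rw [hs]; linarith
  have hs3 : l < s := lt_of_le_of_lt (le_max_left _ _) hs2
  have hs4 : 0 ≤ s := (le_max_right _ _).trans hs2.le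
  have hneg' : ω s < 0 := hsub ⟨hs3, hs1.trans hu⟩
  exact absurd hneg' (not_lt.2 (hpos s ⟨hs4, hs1⟩).le)

/-! ### Continuous induction along a barrier; sign to the right of a contact point -/

/-- **Barrier induction.** `u, v` continuous on `[0, S]`, `B` continuous; if `v 0 ≤ B (u 0)` and at
every contact point `x ∈ [0, S)` (`v x = B (u x)`) the inequality `v ≤ B ∘ u` holds immediately to
the right of `x`, then `v s ≤ B (u s)` on all of `[0, S]` (the set where it holds is closed, contains
`0`, and is open to the right: at non-contact points by continuity). [folklore] -/
theorem barrier_induction {u v B : ℝ → ℝ} {S : ℝ} (hu : ContinuousOn u (Icc 0 S))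
    (hv : ContinuousOn v (Icc 0 S)) (hB : Continuous B) (h0 : v 0 ≤ B (u 0))
    (hstep : ∀ x ∈ Ico 0 S, v x = B (u x) → ∀ᶠ r in 𝓝[>] x, v r ≤ B (u r)) :
    ∀ s ∈ Icc 0 S, v s ≤ B (u s) := by
  intro s hs
  have hS : 0 ≤ S := hs.1.trans hs.2
  set G : Set ℝ := {r | v r ≤ B (u r)} with hG
  have hcont : ContinuousOn (fun r => (v r, B (u r))) (Icc 0 S) :=
    hv.prodMk (hB.comp_continuousOn hu)
  have hclosed : IsClosed (G ∩ Icc 0 S) := by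
    have h := hcont.preimage_isClosed_of_isClosed isClosed_Icc isClosed_le_prod
    rw [inter_comm]
    exact h
  have key : Icc 0 S ⊆ G := by
    refine hclosed.Icc_subset_of_forall_mem_nhdsWithin h0 ?_
    rintro x ⟨hxG, hx⟩
    rcases (show v x ≤ B (u x) from hxG).lt_or_eq with hlt | heq
    · -- strict: by continuity within `[0, S]`, transported to `𝓝[>] x`
      have hcx : ContinuousWithinAt (fun r => B (u r) - v r) (Icc 0 S) x :=
        ((hB.comp_continuousOn hu).sub hv) x (Ico_subset_Icc_self hx)
      have hpos : 0 < B (u x) - v x := by linarith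
      have hev : ∀ᶠ r in 𝓝[Icc 0 S] x, 0 < B (u r) - v r :=
        hcx.eventually (lt_mem_nhds hpos)
      have hle : 𝓝[>] x ≤ 𝓝[Icc 0 S] x := by
        rw [← nhdsWithin_Ioo_eq_nhdsGT hx.2]
        exact nhdsWithin_mono _ fun r hr => ⟨hx.1.trans hr.1.le, hr.2.le⟩
      filter_upwards [hev.filter_mono hle] with r hr
      show v r ≤ B (u r)
      linarith
    · exact hstep x hx heq
  exact key hs

/-- A function vanishing at `x` with positive right derivative there is positive immediately to the
right of `x`. [folklore] -/
theorem eventually_pos_of_hasDerivWithinAt {g : ℝ → ℝ} {g' x : ℝ}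
    (hg : HasDerivWithinAt g g' (Ici x) x) (hgx : g x = 0) (hpos : 0 < g') :
    ∀ᶠ r in 𝓝[>] x, 0 < g r := by
  have h1 : HasDerivWithinAt g g' (Ioi x) x := hg.mono Ioi_subset_Ici_self
  have h2 : Tendsto (slope g x) (𝓝[>] x) (𝓝 g') :=
    (hasDerivWithinAt_iff_tendsto_slope' (show x ∉ Ioi x from lt_irrefl x)).1 h1
  have h3 : ∀ᶠ r in 𝓝[>] x, 0 < slope g x r := h2.eventually (lt_mem_nhds hpos)
  filter_upwards [h3, self_mem_nhdsWithin] with r hr hrx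
  rw [slope_def_field, hgx, sub_zero] at hr
  exact (div_pos_iff_of_pos_right (sub_pos.2 hrx)).1 hr

end Summit.Ventures.GridStability.Models.OrbitGraph

end
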